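import Mathlib
import Literature.Probability.Process.RootedHardCoreConfig
import Literature.Probability.Process.PointStationaryLaw
import Literature.Geometry.DiscreteGeometry.TwoShellPatterns
import Literature.MathematicalPhysics.StatisticalMechanics.Crystallization
import Literature.MathematicalPhysics.StatisticalMechanics.MuGSC
import Summits.AtomisticToContinuum.Crystallization.Theorems.ChartedPlanarOrderPatternWalkHyps

/-!
# Envelope transport for `ChartedZeroExcessLayered` — part 1/4: the twelve-shell on the envelope and the bond-walk iterate

decomp-a2c · lens-3 · generation 12 · crux `ChartedPlanarOrder.ChartedZeroExcessLayered` (stmt-AtomisticToContinuum-26636),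
registered skeleton `ChartedZeroExcessLayered_window_birth.lean` (sha256 660351068daaba86), stub `stub_walkTransportEnvS` (Tc̄ˢ).
The four parts (EnvelopeShell → EnvelopeWalkSums → EnvelopeEnergyTransport → EnvelopeTransport) share this namespace and
prove the stub VERBATIM (`stub_walkTransportEnvS` in part 4).  Part 1: on an envelope-clean configuration (two-shell fcc/hcp
pattern match with tolerance `a/16`, `a ∈ [9/10, 1]`, covering every point at distance `< 3a/2`) every point has EXACTLY twelve
neighbours in the bond shell `0 < dist ≤ 28/25` (`count_bondShell_eq_twelve`, from the Literature two-shell pattern lemmas),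
hence the `n`-step bond walk preserves the law's one-point intensities (`lintegral_bondWalk_iterate_of_envelope`, from the
landed engine `ChartedPlanarOrderBondWalkTransport.lintegral_confWalk_iterate`).  Axioms standard.
-/

set_option maxHeartbeats 800000

namespace Summit.AtomisticToContinuum.Crystallization.Theorems.ChartedPlanarOrderEnvelopeTransport

open MeasureTheory Literature.Geometry.DiscreteGeometry Literature.Probability.Process
open Literature.MathematicalPhysics.StatisticalMechanics
open Summit.AtomisticToContinuum.Crystallization.Theorems.ChartedPlanarOrderBondWalkTransport
open Summit.AtomisticToContinuum.Crystallization.Theorems.ChartedPlanarOrderPatternWalkHyps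
open scoped ENNReal

/-- The first shell (norm-one part) of either two-shell pattern is its kissing pattern: twelve points. -/
theorem card_filter_norm_eq_one_eq_twelve {T : Finset (EuclideanSpace ℝ (Fin 3))}
    (hT : T = fccTwoShellPattern ∨ T = hcpTwoShellPattern) :
    (T.filter (fun v => ‖v‖ = 1)).card = 12 := by
  classical
  have hs2 : Real.sqrt 2 ≠ 1 := by
    intro h
    have := Real.sqrt_eq_one.1 h
    norm_num at this
  rcases hT with rfl | rfl
  · have hsplit : fccTwoShellPattern = scaledPattern fccInt 2 ∪ scaledPattern fccSecondShellInt 2 := by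
      unfold fccTwoShellPattern scaledPattern; exact Finset.image_union _ _
    have heq : fccTwoShellPattern.filter (fun v => ‖v‖ = 1) = fccKissingPattern := by
      apply Finset.Subset.antisymm
      · intro v hv
        rw [Finset.mem_filter, hsplit, Finset.mem_union] at hv
        obtain ⟨h1 | h2, hvn⟩ := hv
        · exact h1
        · exfalso
          obtain ⟨w, hw, hvw⟩ := norm_of_mem_scaledPattern two_ne_zero h2
          have h4 : sqNormInt w = 4 := (by decide : ∀ w ∈ fccSecondShellInt, sqNormInt w = 4) w hw
          rw [h4] at hvw
          have : ‖v‖ = Real.sqrt 2 := by rw [hvw]; norm_num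
          exact hs2 (this ▸ hvn)
      · intro v hv
        exact Finset.mem_filter.2 ⟨fccKissingPattern_subset hv, norm_eq_one_of_mem_fccKissingPattern hv⟩
    rw [heq, card_fccKissingPattern]
  · have hsplit : hcpTwoShellPattern = scaledPattern hcpInt 18 ∪ scaledPattern hcpSecondShellInt 18 := by
      unfold hcpTwoShellPattern scaledPattern; exact Finset.image_union _ _
    have heq : hcpTwoShellPattern.filter (fun v => ‖v‖ = 1) = hcpKissingPattern := by
      apply Finset.Subset.antisymm
      · intro v hv
        rw [Finset.mem_filter, hsplit, Finset.mem_union] at hv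
        obtain ⟨h1 | h2, hvn⟩ := hv
        · exact h1
        · exfalso
          obtain ⟨w, hw, hvw⟩ := norm_of_mem_scaledPattern (by norm_num : (18:ℕ) ≠ 0) h2
          have h4 : sqNormInt w = 36 := (by decide : ∀ w ∈ hcpSecondShellInt, sqNormInt w = 36) w hw
          rw [h4] at hvw
          have : ‖v‖ = Real.sqrt 2 := by rw [hvw]; norm_num
          exact hs2 (this ▸ hvn)
      · intro v hv
        exact Finset.mem_filter.2 ⟨hcpKissingPattern_subset hv, norm_eq_one_of_mem_hcpKissingPattern hv⟩
    rw [heq, card_hcpKissingPattern]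

/-- **Twelve bond neighbours at an envelope-clean point.** -/
theorem count_bondShell_eq_twelve {S : Set (EuclideanSpace ℝ (Fin 3))} (q : EuclideanSpace ℝ (Fin 3))
    (hclean : ∃ a : ℝ, 9 / 10 ≤ a ∧ a ≤ 1 ∧
      ∃ (A : EuclideanSpace ℝ (Fin 3) →ₗᵢ[ℝ] EuclideanSpace ℝ (Fin 3)) (T : Finset (EuclideanSpace ℝ (Fin 3)))
        (f : EuclideanSpace ℝ (Fin 3) → EuclideanSpace ℝ (Fin 3)),
        (T = fccTwoShellPattern ∨ T = hcpTwoShellPattern) ∧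
        (∀ v ∈ T, f v ∈ {p : EuclideanSpace ℝ (Fin 3) |
          ((Measure.count : Measure (EuclideanSpace ℝ (Fin 3))).restrict S) {p} ≠ 0} ∧
          dist (f v) (q + a • A v) ≤ 1 / 16 * a) ∧ Set.InjOn f ↑T ∧
        ∀ y ∈ {p : EuclideanSpace ℝ (Fin 3) | ((Measure.count : Measure (EuclideanSpace ℝ (Fin 3))).restrict S) {p} ≠ 0},
          y ≠ q → dist y q < 3 / 2 * a → ∃ v ∈ T, f v = y) :
    ((Measure.count : Measure (EuclideanSpace ℝ (Fin 3))).restrict S)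
      {y : EuclideanSpace ℝ (Fin 3) | 0 < dist q y ∧ dist q y ≤ 28 / 25} = 12 := by
  classical
  obtain ⟨a, ha1, ha2, A, T, f, hT, hf, hinj, hcov⟩ := hclean
  have hmem : ∀ p : EuclideanSpace ℝ (Fin 3),
      ((Measure.count : Measure (EuclideanSpace ℝ (Fin 3))).restrict S) {p} ≠ 0 ↔ p ∈ S :=
    fun p => count_restrict_singleton_ne_zero_iff S p
  have hsqrt : (141 / 100 : ℝ) < Real.sqrt 2 := by
    rw [show (141 / 100 : ℝ) = Real.sqrt ((141 / 100) ^ 2) by rw [Real.sqrt_sq (by norm_num)]]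
    exact Real.sqrt_lt_sqrt (by norm_num) (by norm_num)
  set K : Finset (EuclideanSpace ℝ (Fin 3)) := T.filter (fun v => ‖v‖ = 1) with hK
  have hKc : K.card = 12 := card_filter_norm_eq_one_eq_twelve hT
  have hKT : (↑K : Set (EuclideanSpace ℝ (Fin 3))) ⊆ ↑T := by
    intro v hv
    exact (Finset.mem_filter.1 (Finset.mem_coe.1 hv)).1
  -- norm of `a • A v`
  have hnorm : ∀ v : EuclideanSpace ℝ (Fin 3), ‖a • A v‖ = a * ‖v‖ := fun v => by
    rw [norm_smul, Real.norm_of_nonneg (by linarith), A.norm_map]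
  have hset : {y : EuclideanSpace ℝ (Fin 3) | 0 < dist q y ∧ dist q y ≤ 28 / 25} ∩ S
      = ↑(K.image f) := by
    ext y
    rw [Finset.coe_image]
    constructor
    · rintro ⟨⟨hpos, hle⟩, hyS⟩
      have hyne : y ≠ q := by
        intro h; rw [h, dist_self] at hpos; exact lt_irrefl _ hpos
      have hlt : dist y q < 3 / 2 * a := by rw [dist_comm]; linarith
      obtain ⟨v, hv, rfl⟩ := hcov y ((hmem y).2 hyS) hyne hlt
      refine ⟨v, ?_, rfl⟩
      rw [Finset.mem_coe, hK, Finset.mem_filter]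
      refine ⟨hv, ?_⟩
      -- norms in either two-shell pattern are `1` or `√2` (Literature `norm_of_mem_fcc/hcpTwoShellPattern`)
      have hvnorm : ‖v‖ = 1 ∨ ‖v‖ = Real.sqrt 2 := by
        rcases hT with rfl | rfl
        · exact norm_of_mem_fccTwoShellPattern hv
        · exact norm_of_mem_hcpTwoShellPattern hv
      rcases hvnorm with h1 | h2
      · exact h1
      · exfalso
        have hd : dist (q + a • A v) q = ‖a • A v‖ := by rw [dist_eq_norm, add_sub_cancel_left]
        have htri : dist (q + a • A v) q ≤ dist (q + a • A v) (f v) + dist (f v) q := dist_triangle _ _ _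
        rw [hd, hnorm, h2, dist_comm (q + a • A v) (f v), dist_comm (f v) q] at htri
        have h1' := (hf v hv).2
        nlinarith
    · rintro ⟨v, hv, rfl⟩
      rw [Finset.mem_coe, hK, Finset.mem_filter] at hv
      obtain ⟨hvT, hv1⟩ := hv
      have h1 := (hf v hvT).2
      have hd : dist (q + a • A v) q = a := by rw [dist_eq_norm, add_sub_cancel_left, hnorm, hv1, mul_one]
      have htri1 : dist (q + a • A v) q ≤ dist (q + a • A v) (f v) + dist (f v) q := dist_triangle _ _ _
      have htri2 : dist (f v) q ≤ dist (f v) (q + a • A v) + dist (q + a • A v) q := dist_triangle _ _ _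
      rw [hd] at htri1 htri2
      rw [dist_comm (q + a • A v) (f v)] at htri1
      refine ⟨⟨?_, ?_⟩, (hmem _).1 (hf v hvT).1⟩
      · rw [dist_comm]; linarith
      · rw [dist_comm]; linarith
  have hBm : MeasurableSet {y : EuclideanSpace ℝ (Fin 3) | 0 < dist q y ∧ dist q y ≤ 28 / 25} :=
    (measurableSet_lt measurable_const (measurable_const.dist measurable_id)).inter
      (measurableSet_le (measurable_const.dist measurable_id) measurable_const)
  rw [Measure.restrict_apply hBm, hset, Measure.count_apply_finset,
    Finset.card_image_of_injOn (hinj.mono hKT), hKc]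
  norm_num

/-- **Root degree twelve, a.s., for laws of the envelope class.** -/
theorem ae_shell_eq_twelve_of_envelope {δ : ℝ} {P : Measure (Measure (EuclideanSpace ℝ (Fin 3)))}
    (hroot : ∀ᵐ μ ∂P, ∃ S : Set (EuclideanSpace ℝ (Fin 3)), (0 : EuclideanSpace ℝ (Fin 3)) ∈ S ∧
      (∀ x ∈ S, ∀ y ∈ S, x ≠ y → δ ≤ dist x y) ∧
      μ = (Measure.count : Measure (EuclideanSpace ℝ (Fin 3))).restrict S)
    (hclean : ∀ᵐ μ ∂P, ∀ q : EuclideanSpace ℝ (Fin 3), μ {q} ≠ 0 → (∃ a : ℝ, 9 / 10 ≤ a ∧ a ≤ 1 ∧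
      ∃ (A : EuclideanSpace ℝ (Fin 3) →ₗᵢ[ℝ] EuclideanSpace ℝ (Fin 3)) (T : Finset (EuclideanSpace ℝ (Fin 3)))
        (f : EuclideanSpace ℝ (Fin 3) → EuclideanSpace ℝ (Fin 3)),
        (T = fccTwoShellPattern ∨ T = hcpTwoShellPattern) ∧
        (∀ v ∈ T, f v ∈ {p : EuclideanSpace ℝ (Fin 3) | μ {p} ≠ 0} ∧ dist (f v) (q + a • A v) ≤ 1 / 16 * a) ∧
        Set.InjOn f ↑T ∧
        ∀ y ∈ {p : EuclideanSpace ℝ (Fin 3) | μ {p} ≠ 0}, y ≠ q → dist y q < 3 / 2 * a → ∃ v ∈ T, f v = y)) :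
    ∀ᵐ μ ∂P, μ {y : EuclideanSpace ℝ (Fin 3) | 0 < dist (0 : EuclideanSpace ℝ (Fin 3)) y ∧
      dist (0 : EuclideanSpace ℝ (Fin 3)) y ≤ 28 / 25} = 12 := by
  filter_upwards [hroot, hclean] with μ hμ hcl
  obtain ⟨S, h0, -, rfl⟩ := hμ
  exact count_bondShell_eq_twelve (S := S) 0 (hcl 0 ((count_restrict_singleton_ne_zero_iff S 0).2 h0))

/-- **Bond-walk transport for point-stationary laws of the envelope class** (`ℝ≥0∞` form): for every measurable
`F ≥ 0` and every `n`, `∫⁻ μ, (W_μ^n (y ↦ F (θ_y μ))) 0 ∂P = ∫⁻ F ∂P` with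
`(W_μ h)(x) = 12⁻¹ ∫⁻ y, 1_{B₀}(y − x) h y ∂μ`.  Engine: `lintegral_confWalk_iterate` (p783133). -/
theorem lintegral_bondWalk_iterate_of_envelope {δ : ℝ} (hδ : 0 < δ)
    {P : Measure (Measure (EuclideanSpace ℝ (Fin 3)))} (hP : IsPointStationaryLaw P)
    (hroot : ∀ᵐ μ ∂P, ∃ S : Set (EuclideanSpace ℝ (Fin 3)), (0 : EuclideanSpace ℝ (Fin 3)) ∈ S ∧
      (∀ x ∈ S, ∀ y ∈ S, x ≠ y → δ ≤ dist x y) ∧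
      μ = (Measure.count : Measure (EuclideanSpace ℝ (Fin 3))).restrict S)
    (hclean : ∀ᵐ μ ∂P, ∀ q : EuclideanSpace ℝ (Fin 3), μ {q} ≠ 0 → (∃ a : ℝ, 9 / 10 ≤ a ∧ a ≤ 1 ∧
      ∃ (A : EuclideanSpace ℝ (Fin 3) →ₗᵢ[ℝ] EuclideanSpace ℝ (Fin 3)) (T : Finset (EuclideanSpace ℝ (Fin 3)))
        (f : EuclideanSpace ℝ (Fin 3) → EuclideanSpace ℝ (Fin 3)),
        (T = fccTwoShellPattern ∨ T = hcpTwoShellPattern) ∧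
        (∀ v ∈ T, f v ∈ {p : EuclideanSpace ℝ (Fin 3) | μ {p} ≠ 0} ∧ dist (f v) (q + a • A v) ≤ 1 / 16 * a) ∧
        Set.InjOn f ↑T ∧
        ∀ y ∈ {p : EuclideanSpace ℝ (Fin 3) | μ {p} ≠ 0}, y ≠ q → dist y q < 3 / 2 * a → ∃ v ∈ T, f v = y))
    {F : Measure (EuclideanSpace ℝ (Fin 3)) → ℝ≥0∞} (hF : Measurable F) (n : ℕ) :
    ∫⁻ μ, ((fun (h : EuclideanSpace ℝ (Fin 3) → ℝ≥0∞) (x : EuclideanSpace ℝ (Fin 3)) =>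
        (12 : ℝ≥0∞)⁻¹ * ∫⁻ y, ((fun y => y - x) ⁻¹'
          {v : EuclideanSpace ℝ (Fin 3) | 0 < dist (0 : EuclideanSpace ℝ (Fin 3)) v ∧
            dist (0 : EuclideanSpace ℝ (Fin 3)) v ≤ 28 / 25}).indicator h y ∂μ)^[n]
        (fun y => F (Measure.map (fun z => z - y) μ))) 0 ∂P
      = ∫⁻ μ, F μ ∂P := by
  have hBm : MeasurableSet {v : EuclideanSpace ℝ (Fin 3) | 0 < dist (0 : EuclideanSpace ℝ (Fin 3)) v ∧
      dist (0 : EuclideanSpace ℝ (Fin 3)) v ≤ 28 / 25} :=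
    (measurableSet_lt measurable_const (measurable_const.dist measurable_id)).inter
      (measurableSet_le (measurable_const.dist measurable_id) measurable_const)
  have hBsymm : ∀ y : EuclideanSpace ℝ (Fin 3),
      -y ∈ {v : EuclideanSpace ℝ (Fin 3) | 0 < dist (0 : EuclideanSpace ℝ (Fin 3)) v ∧
        dist (0 : EuclideanSpace ℝ (Fin 3)) v ≤ 28 / 25} ↔
      y ∈ {v : EuclideanSpace ℝ (Fin 3) | 0 < dist (0 : EuclideanSpace ℝ (Fin 3)) v ∧
        dist (0 : EuclideanSpace ℝ (Fin 3)) v ≤ 28 / 25} := by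
    intro y
    simp only [Set.mem_setOf_eq, dist_eq_norm, zero_sub, norm_neg]
  exact lintegral_confWalk_iterate hP (ae_floorNorm_lt_top_of_rooted hδ hroot) hBm hBsymm
    (by norm_num) (by norm_num) (ae_shell_eq_twelve_of_envelope hroot hclean) hF n

/-- The same, with the Mecke identity passed UNFOLDED (the verbatim hypothesis of `TcEnv`). -/
theorem lintegral_bondWalk_iterate_of_envelope' {δ : ℝ} (hδ : 0 < δ)
    {P : Measure (Measure (EuclideanSpace ℝ (Fin 3)))}
    (hMecke : ∀ g : Measure (EuclideanSpace ℝ (Fin 3)) → EuclideanSpace ℝ (Fin 3) → ℝ≥0∞,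
      Measurable (Function.uncurry g) →
      ∫⁻ μ, ∫⁻ y, g μ y ∂μ ∂P = ∫⁻ μ, ∫⁻ y, g (Measure.map (fun z => z - y) μ) (-y) ∂μ ∂P)
    (hroot : ∀ᵐ μ ∂P, ∃ S : Set (EuclideanSpace ℝ (Fin 3)), (0 : EuclideanSpace ℝ (Fin 3)) ∈ S ∧
      (∀ x ∈ S, ∀ y ∈ S, x ≠ y → δ ≤ dist x y) ∧
      μ = (Measure.count : Measure (EuclideanSpace ℝ (Fin 3))).restrict S)
    (hclean : ∀ᵐ μ ∂P, ∀ q : EuclideanSpace ℝ (Fin 3), μ {q} ≠ 0 → (∃ a : ℝ, 9 / 10 ≤ a ∧ a ≤ 1 ∧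
      ∃ (A : EuclideanSpace ℝ (Fin 3) →ₗᵢ[ℝ] EuclideanSpace ℝ (Fin 3)) (T : Finset (EuclideanSpace ℝ (Fin 3)))
        (f : EuclideanSpace ℝ (Fin 3) → EuclideanSpace ℝ (Fin 3)),
        (T = fccTwoShellPattern ∨ T = hcpTwoShellPattern) ∧
        (∀ v ∈ T, f v ∈ {p : EuclideanSpace ℝ (Fin 3) | μ {p} ≠ 0} ∧ dist (f v) (q + a • A v) ≤ 1 / 16 * a) ∧
        Set.InjOn f ↑T ∧
        ∀ y ∈ {p : EuclideanSpace ℝ (Fin 3) | μ {p} ≠ 0}, y ≠ q → dist y q < 3 / 2 * a → ∃ v ∈ T, f v = y))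
    {F : Measure (EuclideanSpace ℝ (Fin 3)) → ℝ≥0∞} (hF : Measurable F) (n : ℕ) :
    ∫⁻ μ, ((fun (h : EuclideanSpace ℝ (Fin 3) → ℝ≥0∞) (x : EuclideanSpace ℝ (Fin 3)) =>
        (12 : ℝ≥0∞)⁻¹ * ∫⁻ y, ((fun y => y - x) ⁻¹'
          {v : EuclideanSpace ℝ (Fin 3) | 0 < dist (0 : EuclideanSpace ℝ (Fin 3)) v ∧
            dist (0 : EuclideanSpace ℝ (Fin 3)) v ≤ 28 / 25}).indicator h y ∂μ)^[n]
        (fun y => F (Measure.map (fun z => z - y) μ))) 0 ∂P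
      = ∫⁻ μ, F μ ∂P :=
  lintegral_bondWalk_iterate_of_envelope hδ ((isPointStationaryLaw_iff P).2 hMecke) hroot hclean hF n

end Summit.AtomisticToContinuum.Crystallization.Theorems.ChartedPlanarOrderEnvelopeTransport
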